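import Mathlib
import Summits.ResolutionOfSingularities.ResolutionOfSingularities.Theorems.RadicialJungCleanModelsCleanLU3CompositeUpstairs
import Summits.ResolutionOfSingularities.ResolutionOfSingularities.Theorems.RadicialJungCleanModelsCleanLU3CompositeDivisorialPrelims
import Summits.ResolutionOfSingularities.ResolutionOfSingularities.Theorems.RadicialJungCleanModelsCleanLU3CompositeDivisorialHeight
import Literature.AlgebraicGeometry.Resolution.ArithmeticalThreefoldsLocalRankReduction
import Literature.AlgebraicGeometry.Resolution.ExcellentRingsFieldProofs
import Literature.AlgebraicGeometry.Resolution.ExcellentRingsEssFiniteType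
import Literature.AlgebraicGeometry.Resolution.ExcellentClosedSubschemes
import HarnessLib

/-!
# Route `RadicialJung`, crux `CleanModels` (stmt-15917), stub `stub_cleanLU3DefectNonDiscrete`, sub-line (C-div), piece F1:
# the GENERAL divisorial coarsening — reduction to the height-one case by local uniformization at the composite valuation

Line `Sketch` rev 24 of crux stmt-ResolutionOfSingularities-15917; lead `res-B-lead-1` g4 (workfile `Lines/Sketch_Cdiv_assembly.lean` v2.1,
piece F1).  OURS; nothing here proves resolution in characteristic `p`.

`cleanLU3Defect_of_divisorialCoarsening_of`: the hypotheses of `stub_cleanLU3DefectNonDiscrete` used by the (C-div) sub-line, PLUS a coarsening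
`O ≤ O₁ ≠ K` and two elements `y₁, y₂ ∈ O` whose residues in `κ(O₁)` are algebraically independent over `k` (every nonzero `k`-polynomial in
them is a unit of `O₁` — the divisorial case: `trdeg_k κ(O₁) = 2`), PLUS `hEmb` (F-32), `CossartJannsenSaito2020General` (F-78) and the two
delegable stubs `hLU2`, `hpersist` of the workfile ⟹ the conclusion of the stub.  Reduction to `cleanLU3Defect_of_heightOneCoarsening_of`
(`…CompositeUpstairs.lean`): `O ≠ O₁` (the centre of `O` on `A[y₁]` is closed, `exists_poly_unit_coeff_of_centres_isMaximal`); local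
uniformization ALONG THE COMPOSITE VALUATION `O` in dimension three (`exists_model_regular_of_lt_of_cjs`, Cossart–Piltant 2019 Prop. 4.10 via
Novacoski–Spivakovsky, over the excellent regular base `S = locAtCentre A O`) yields a finitely generated `k`-model `A₃ ⊇ A ∪ {y₁, y₂}` inside `O`,
regular at the centre of `O` (`exists_regular_model_containing`); its dimension is `3` (`ringKrullDim_eq_of_fg_of_le`,
`ringKrullDim_locAtCentre_eq_of_isMaximal`), so the centre of `O₁` on it has height one and `locAtCentre (locAtCentre A₃ O) O₁ = O₁`
(`locAtCentre_locAtCentre_eq_of_residually_independent`, `…CompositeDivisorialHeight.lean`).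
-/

noncomputable section

set_option linter.dupNamespace false -- mandated namespace of this single-conjunct summit

open IsLocalRing AlgebraicGeometry CategoryTheory Polynomial
open Literature.AlgebraicGeometry.Resolution

namespace Summit.ResolutionOfSingularities.ResolutionOfSingularities.Theorems.RadicialJung.CleanModels

section Prelims

variable {K : Type} [Field K] {k : Type} [Field k] [Algebra k K]

/-- **The local ring of a finitely generated model at a centre is excellent** (finitely generated algebras over a field are excellent,
and so are their localisations). [cite: Matsumura1987, §32 p. 260] -/
theorem isExcellentRing_locAtCentre (A : Subalgebra k K) (hAfg : A.FG) (O : ValuationSubring K)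
    (hAO : A.toSubring ≤ O.toSubring) : IsExcellentRing (locAtCentre A.toSubring O) := by
  letI : Algebra k A.toSubring := inferInstanceAs (Algebra k A)
  haveI : Algebra.FiniteType k A.toSubring := (A.fg_iff_finiteType.mp hAfg : Algebra.FiniteType k A)
  have hA : IsExcellentRing A.toSubring := isExcellentRing_of_finiteType_field k A.toSubring
  have hloc := isExcellentRing_localization_atPrime hA (B := A.toSubring) (subringCentre A.toSubring O hAO)
  exact IsExcellentRing.of_ringEquiv (locAtCentreEquiv hAO).toRingEquiv hloc

/-- **Residual algebraicity over the local ring** (hypothesis `hres` of `exists_model_regular_of_lt_of_cjs`): if every centre above `A` is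
closed, every `y ∈ O` satisfies a polynomial over `S = locAtCentre A O` with a unit coefficient and value `< 1` at `y` (the minimal polynomial
of the residue of `y` over `k`, `exists_poly_unit_coeff_of_centres_isMaximal`). [folklore] -/
theorem exists_poly_unit_coeff_locAtCentre (O : ValuationSubring K) (A : Subalgebra k K)
    (hAO : A.toSubring ≤ O.toSubring) (hAfg : A.FG)
    (hzd : ∀ (T : Subring K) (hT : T ≤ O.toSubring), A.toSubring ≤ T → (subringCentre T O hT).IsMaximal)
    [IsLocalRing (locAtCentre A.toSubring O)] (y : O) :
    ∃ q : (locAtCentre A.toSubring O)[X], (∃ i, q.coeff i ∉ maximalIdeal (locAtCentre A.toSubring O)) ∧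
      O.valuation (q.eval₂ (algebraMap (locAtCentre A.toSubring O) K) y) < 1 := by
  obtain ⟨m, hm, hv⟩ := exists_poly_unit_coeff_of_centres_isMaximal O A hAO hAfg hzd (y : K) y.2
  let φ : k →+* locAtCentre A.toSubring O :=
    (Subring.inclusion (le_locAtCentre A.toSubring O)).comp (algebraMap k A : k →+* A.toSubring)
  have hφ : (algebraMap (locAtCentre A.toSubring O) K).comp φ = algebraMap k K := RingHom.ext fun c => rfl
  refine ⟨m.map φ, ⟨m.natDegree, ?_⟩, ?_⟩
  · rw [coeff_map, hm.coeff_natDegree, map_one]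
    exact fun h => (maximalIdeal.isMaximal _).ne_top (Ideal.eq_top_of_isUnit_mem _ h isUnit_one)
  · rw [eval₂_map, hφ]
    exact hv

/-- **`O ≠ O₁` in the divisorial case**: if `y₁, y₂ ∈ O` have residues in `κ(O₁)` algebraically independent over `k` while every centre of `O`
above `A` is closed, then `O ≠ O₁` (the residue of `y₁` in `κ(O)` is algebraic over `k`). [folklore] -/
theorem ne_of_residually_independent (O O₁ : ValuationSubring K) (A : Subalgebra k K) (hAO : A.toSubring ≤ O.toSubring)
    (hAfg : A.FG) (hzd : ∀ (T : Subring K) (hT : T ≤ O.toSubring), A.toSubring ≤ T → (subringCentre T O hT).IsMaximal)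
    (y : Fin 2 → K) (hy : ∀ i, y i ∈ O)
    (hind : ∀ P : MvPolynomial (Fin 2) k, P ≠ 0 → O₁.valuation (MvPolynomial.aeval y P) = 1) : O ≠ O₁ := by
  rintro rfl
  obtain ⟨m, hm, hv⟩ := exists_poly_unit_coeff_of_centres_isMaximal O A hAO hAfg hzd (y 0) (hy 0)
  -- the polynomial `m(X₀)` in two variables
  set P : MvPolynomial (Fin 2) k := Polynomial.aeval (MvPolynomial.X (0 : Fin 2) : MvPolynomial (Fin 2) k) m with hP
  have hPeval : ∀ {B : Type} [CommRing B] [Algebra k B] (g : Fin 2 → B),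
      MvPolynomial.aeval g P = Polynomial.aeval (g 0) m := by
    intro B _ _ g
    rw [hP, ← Polynomial.aeval_algHom_apply, MvPolynomial.aeval_X]
  have hP0 : P ≠ 0 := by
    intro h0
    have h := hPeval (fun _ : Fin 2 => (Polynomial.X : k[X]))
    rw [h0, map_zero, Polynomial.aeval_X_left, AlgHom.coe_id, id_eq] at h
    exact hm.ne_zero h.symm
  have h1 := hind P hP0
  rw [hPeval] at h1
  rw [h1] at hv
  exact lt_irrefl _ hv

/-- **A regular model containing prescribed elements, by local uniformization along the composite valuation** (Cossart–Piltant 2019,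
Prop. 4.10, through `exists_model_regular_of_lt_of_cjs` over the excellent regular base `S = locAtCentre A O` of dimension three, modulo
`CossartJannsenSaito2020General`): for `O < O₁ < K` with every centre above `A` closed and a finite `t ⊆ O`, some finitely generated `k`-model
`A₃ ⊇ A ∪ t` inside `O` is regular at the centre of `O`. [cite: CossartPiltant2019, Prop. 4.10] -/
theorem exists_regular_model_containing (h78 : CossartJannsenSaito2020General.{0})
    (O O₁ : ValuationSubring K) (hOO₁ : O ≤ O₁) (hne : O ≠ O₁) (hO₁ : O₁ ≠ ⊤)
    (A : Subalgebra k K) (hAO : A.toSubring ≤ O.toSubring) (hAfg : A.FG) [IsFractionRing A K]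
    (hreg : IsRegularLocalRing (locAtCentre A.toSubring O)) (hdim3 : ringKrullDim (locAtCentre A.toSubring O) = 3)
    (hzd : ∀ (T : Subring K) (hT : T ≤ O.toSubring), A.toSubring ≤ T → (subringCentre T O hT).IsMaximal)
    (t : Finset K) (htO : (↑t : Set K) ⊆ O) :
    ∃ A₃ : Subalgebra k K, A₃.toSubring ≤ O.toSubring ∧ A ≤ A₃ ∧ A₃.FG ∧ (↑t : Set K) ⊆ A₃ ∧
      IsRegularLocalRing (locAtCentre A₃.toSubring O) := by
  classical
  haveI := hreg
  set S : Subring K := locAtCentre A.toSubring O with hSdef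
  have hSO : S ≤ O.toSubring := locAtCentre_le hAO
  have hAS : A.toSubring ≤ S := le_locAtCentre A.toSubring O
  -- `Frac S = K`, so `K` is algebraic over `S`
  have hfracS := (isLocalRingOf_locAtCentre A O hAO).2
  haveI : IsFractionRing S K := IsFractionRing.of_field S K fun z => by
    obtain ⟨a, ha, b, hb, -, rfl⟩ := hfracS z
    exact ⟨⟨a, ha⟩, ⟨b, hb⟩, rfl⟩
  haveI : Algebra.IsAlgebraic S K := IsLocalization.isAlgebraic K (nonZeroDivisors S)
  have hexc : IsExcellentRing S := isExcellentRing_locAtCentre A hAfg O hAO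
  have hSO' : ∀ s : S, algebraMap S K s ∈ O := fun s => hSO s.2
  have hdom : ∀ s ∈ maximalIdeal S, O.valuation (algebraMap S K s) < 1 := fun s hs =>
    (not_isUnit_locAtCentre_iff hAO s).mp hs
  have hres := exists_poly_unit_coeff_locAtCentre O A hAO hAfg hzd
  -- the model `S[t]`
  let O' : Subalgebra S K := { O.toSubring with algebraMap_mem' := hSO' }
  set R : Subalgebra S K := Algebra.adjoin S (↑t : Set K) with hRdef
  have hRfg : R.FG := ⟨t, rfl⟩
  have hRO : R.toSubring ≤ O.toSubring := by
    have h : R ≤ O' := Algebra.adjoin_le htO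
    exact fun z hz => h hz
  haveI : IsFractionRing R K := IsFractionRing.of_field R K fun z => by
    obtain ⟨a, ha, b, hb, -, rfl⟩ := hfracS z
    exact ⟨⟨a, R.algebraMap_mem ⟨a, ha⟩⟩, ⟨b, R.algebraMap_mem ⟨b, hb⟩⟩, rfl⟩
  -- local uniformization along `O`
  obtain ⟨A', hA'O, hRA', hA'fg, hregA'⟩ :=
    exists_model_regular_of_lt_of_cjs h78 hexc hdim3 O O₁ hOO₁ hne hO₁ hSO' hdom hres R hRfg hRO
  have hreg' : IsRegularLocalRing (locAtCentre A'.toSubring O) :=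
    (isRegularLocalRing_locAtCentre_iff hA'O).mpr hregA'
  have hSA' : S ≤ A'.toSubring := fun s hs => A'.algebraMap_mem ⟨s, hs⟩
  obtain ⟨t', ht'⟩ := hA'fg
  have ht'A' : (↑t' : Set K) ⊆ A' := by rw [← ht']; exact Algebra.subset_adjoin
  have htA' : (↑t : Set K) ⊆ A' := fun z hz => hRA' (Algebra.subset_adjoin hz)
  -- the `k`-model `A₃ = A[t, t']`
  obtain ⟨A₃, hA₃eq, hAA₃, hA₃fg⟩ := exists_subalgebra_closure A (t ∪ t')
  have hA₃A' : A₃.toSubring ≤ A'.toSubring := by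
    rw [hA₃eq, Subring.closure_le]
    rintro z (hz | hz)
    · exact hSA' (hAS hz)
    · rw [Finset.coe_union] at hz
      rcases hz with hz | hz
      · exact htA' hz
      · exact ht'A' hz
  have hA₃O : A₃.toSubring ≤ O.toSubring := hA₃A'.trans hA'O
  have htA₃ : (↑(t ∪ t') : Set K) ⊆ A₃ := fun z hz => by
    change z ∈ A₃.toSubring
    rw [hA₃eq]
    exact Subring.subset_closure (Or.inr hz)
  refine ⟨A₃, hA₃O, hAA₃, hA₃fg hAfg, fun z hz => htA₃ (by rw [Finset.coe_union]; exact Or.inl hz), ?_⟩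
  -- `locAtCentre A₃ O = locAtCentre A' O`
  have hle₁ : locAtCentre A₃.toSubring O ≤ locAtCentre A'.toSubring O := locAtCentre_mono O hA₃A'
  have hle₂ : A'.toSubring ≤ locAtCentre A₃.toSubring O := by
    let L₃ : Subalgebra S K :=
      { locAtCentre A₃.toSubring O with
        algebraMap_mem' := fun s => locAtCentre_mono O (show A.toSubring ≤ A₃.toSubring from fun z hz => hAA₃ hz) s.2 }
    have h : A' ≤ L₃ := by
      rw [← ht']
      refine Algebra.adjoin_le fun z hz => ?_
      exact le_locAtCentre A₃.toSubring O (htA₃ (by rw [Finset.coe_union]; exact Or.inr hz))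
    exact fun z hz => h hz
  have heq : locAtCentre A₃.toSubring O = locAtCentre A'.toSubring O := by
    refine le_antisymm hle₁ ?_
    calc locAtCentre A'.toSubring O ≤ locAtCentre (locAtCentre A₃.toSubring O) O := locAtCentre_mono O hle₂
      _ = locAtCentre A₃.toSubring O := locAtCentre_locAtCentre _ O
  rw [heq]
  exact hreg'

end Prelims

/-- **(C-div), general divisorial case, modulo `hEmb`, `CossartJannsenSaito2020General`, `stub_cleanLU2`, `stub_persistStep`.**  See the
module docstring. [folklore] -/
theorem cleanLU3Defect_of_divisorialCoarsening_of
    (hEmb : ∀ (Z : Scheme.{0}) [IsIntegral Z] [IsNoetherian Z], Scheme.IsRegular Z →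
      Scheme.IsExcellent Z → ∀ (X : Set Z), IsClosed X → X ≠ Set.univ → topologicalKrullDim X ≤ 2 →
        ∃ (Z' : Scheme.{0}) (π : Z' ⟶ Z), IsProper π ∧ Function.Surjective π.base ∧
          (∃ U : Z.Opens, (U : Set Z) = Xᶜ ∧ IsIso (π ∣_ U)) ∧
          IsStrictNormalCrossingsDivisor Z' (π.base ⁻¹' X))
    (h78 : CossartJannsenSaito2020General.{0})
    (p : ℕ) (hp : p.Prime) (k : Type) [Field k] [CharP k p]
    (hLU2 : ∀ (κ : Type) [Field κ] [Algebra k κ]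
      (Ō : ValuationSubring κ) (Ā : Subalgebra k κ), Ā.toSubring ≤ Ō.toSubring → Ā.FG → IsFractionRing Ā κ →
      IsRegularLocalRing (locAtCentre Ā.toSubring Ō) →
      ringKrullDim (locAtCentre Ā.toSubring Ō) = 2 →
      (∀ (T : Subring κ) (hT : T ≤ Ō.toSubring), Ā.toSubring ≤ T → (subringCentre T Ō hT).IsMaximal) →
      ∀ ū : κ, (∀ c : κ, c ^ p ≠ ū) →
      ∃ (Ā' : Subalgebra k κ), Ā'.toSubring ≤ Ō.toSubring ∧ Ā ≤ Ā' ∧ Ā'.FG ∧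
      ∃ (_ : IsRegularLocalRing (locAtCentre Ā'.toSubring Ō)) (c : Fin p → κ), (∃ j : Fin p, (j : ℕ) ≠ 0 ∧ c j ≠ 0) ∧
      ((∃ (d m : ℕ) (hmd : m ≤ d) (t : Fin d → ↥(locAtCentre Ā'.toSubring Ō)) (a : Fin m → ℕ) (u : ↥(locAtCentre Ā'.toSubring Ō)), IsUnit u ∧
      Ideal.span (Set.range t) = IsLocalRing.maximalIdeal ↥(locAtCentre Ā'.toSubring Ō) ∧
      ringKrullDim ↥(locAtCentre Ā'.toSubring Ō) = (d : WithBot ℕ∞) ∧ 0 < m ∧ (∀ i, ¬ p ∣ a i) ∧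
      (∑ j : Fin p, c j ^ p * ū ^ (j : ℕ)) = (u : κ) * ∏ i : Fin m, ((t (Fin.castLE hmd i) : ↥(locAtCentre Ā'.toSubring Ō)) : κ) ^ (a i)) ∨
      (∃ u : ↥(locAtCentre Ā'.toSubring Ō), IsUnit u ∧ (∑ j : Fin p, c j ^ p * ū ^ (j : ℕ)) = (u : κ) ∧
      ∀ c' : ↥(locAtCentre Ā'.toSubring Ō), u - c' ^ p ∉ IsLocalRing.maximalIdeal ↥(locAtCentre Ā'.toSubring Ō)) ∨
      (∃ s c' : ↥(locAtCentre Ā'.toSubring Ō), (∑ j : Fin p, c j ^ p * ū ^ (j : ℕ)) = (s : κ) ∧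
      s - c' ^ p ∈ IsLocalRing.maximalIdeal ↥(locAtCentre Ā'.toSubring Ō) ∧
      s - c' ^ p ∉ IsLocalRing.maximalIdeal ↥(locAtCentre Ā'.toSubring Ō) ^ 2)))
    (hpersist : ∀ (κ : Type) [Field κ] [CharP κ p]
      (Ō : ValuationSubring κ) (S S' : Subring κ) [IsRegularLocalRing S] [IsRegularLocalRing S'],
      ringKrullDim S = 2 → ringKrullDim S' = 2 → IsLocalRingOf S → IsQuadraticTransformAlong Ō S S' →
      SubringDominates S Ō.toSubring →
      ∀ (ū d : κ), d ∈ S → d ≠ 0 →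
      ∀ (c : Fin p → κ), (∃ j : Fin p, (j : ℕ) ≠ 0 ∧ c j ≠ 0) →
      ∀ (x y : S), maximalIdeal S = Ideal.span {x, y} →
      ∀ (α β : ℕ), (∀ j : Fin p, c j * d * (x : κ) ^ α * (y : κ) ^ β ∈ S) →
      ((∃ (a b : ℕ) (ε : S), IsUnit ε ∧ (a ≠ 0 ∨ b ≠ 0) ∧ (a = 0 ∨ ¬ p ∣ a) ∧ (b = 0 ∨ ¬ p ∣ b) ∧
          (∑ j : Fin p, c j ^ p * ū ^ (j : ℕ)) = (ε : κ) * (x : κ) ^ a * (y : κ) ^ b) ∨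
        (∃ u : S, IsUnit u ∧ (∑ j : Fin p, c j ^ p * ū ^ (j : ℕ)) = (u : κ) ∧ ∀ c' : S, u - c' ^ p ∉ maximalIdeal S) ∨
        (∃ s c' : S, (∑ j : Fin p, c j ^ p * ū ^ (j : ℕ)) = (s : κ) ∧ s - c' ^ p ∈ maximalIdeal S ∧ s - c' ^ p ∉ maximalIdeal S ^ 2)) →
      ∃ (c' : Fin p → κ), (∃ j : Fin p, (j : ℕ) ≠ 0 ∧ c' j ≠ 0) ∧
      ∃ (x' y' : S'), maximalIdeal S' = Ideal.span {x', y'} ∧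
      ∃ (α' β' : ℕ), (∀ j : Fin p, c' j * d * (x' : κ) ^ α' * (y' : κ) ^ β' ∈ S') ∧
      ((∃ (a b : ℕ) (ε : S'), IsUnit ε ∧ (a ≠ 0 ∨ b ≠ 0) ∧ (a = 0 ∨ ¬ p ∣ a) ∧ (b = 0 ∨ ¬ p ∣ b) ∧
          (∑ j : Fin p, c' j ^ p * ū ^ (j : ℕ)) = (ε : κ) * (x' : κ) ^ a * (y' : κ) ^ b) ∨
        (∃ u : S', IsUnit u ∧ (∑ j : Fin p, c' j ^ p * ū ^ (j : ℕ)) = (u : κ) ∧ ∀ c'' : S', u - c'' ^ p ∉ maximalIdeal S') ∨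
        (∃ s c'' : S', (∑ j : Fin p, c' j ^ p * ū ^ (j : ℕ)) = (s : κ) ∧ s - c'' ^ p ∈ maximalIdeal S' ∧ s - c'' ^ p ∉ maximalIdeal S' ^ 2)))
    (K : Type) [Field K] [Algebra k K]
    (O : ValuationSubring K) (A : Subalgebra k K) (hAO : A.toSubring ≤ O.toSubring) (hAfg : A.FG)
    (hfrac : IsFractionRing A K)
    (hreg : IsRegularLocalRing (locAtCentre A.toSubring O))
    (hdim3 : ringKrullDim (locAtCentre A.toSubring O) = 3)
    (hzd : ∀ (T : Subring K) (hT : T ≤ O.toSubring), A.toSubring ≤ T → (subringCentre T O hT).IsMaximal)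
    (g₀ : K) (hg₀ : ∀ c : K, c ^ p ≠ g₀)
    (hdefect : ∀ f₀ : K, ∃ f₁ : K, O.valuation (g₀ - f₁ ^ p) < O.valuation (g₀ - f₀ ^ p))
    (O₁ : ValuationSubring K) (hOO₁ : O ≤ O₁) (hO₁ : O₁ ≠ ⊤)
    (y : Fin 2 → K) (hy : ∀ i, y i ∈ O)
    (hind : ∀ P : MvPolynomial (Fin 2) k, P ≠ 0 → O₁.valuation (MvPolynomial.aeval y P) = 1) :
    ∃ (A' : Subalgebra k K), A'.toSubring ≤ O.toSubring ∧ A ≤ A' ∧ A'.FG ∧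
    ∃ (_ : IsRegularLocalRing (locAtCentre A'.toSubring O)) (c : Fin p → K), (∃ j : Fin p, (j : ℕ) ≠ 0 ∧ c j ≠ 0) ∧
    ((∃ (d m : ℕ) (hmd : m ≤ d) (t : Fin d → ↥(locAtCentre A'.toSubring O)) (a : Fin m → ℕ) (u : ↥(locAtCentre A'.toSubring O)), IsUnit u ∧
    Ideal.span (Set.range t) = IsLocalRing.maximalIdeal ↥(locAtCentre A'.toSubring O) ∧
    ringKrullDim ↥(locAtCentre A'.toSubring O) = (d : WithBot ℕ∞) ∧ 0 < m ∧ (∀ i, ¬ p ∣ a i) ∧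
    (∑ j : Fin p, c j ^ p * g₀ ^ (j : ℕ)) = (u : K) * ∏ i : Fin m, ((t (Fin.castLE hmd i) : ↥(locAtCentre A'.toSubring O)) : K) ^ (a i)) ∨
    (∃ u : ↥(locAtCentre A'.toSubring O), IsUnit u ∧ (∑ j : Fin p, c j ^ p * g₀ ^ (j : ℕ)) = (u : K) ∧
    ∀ c' : ↥(locAtCentre A'.toSubring O), u - c' ^ p ∉ IsLocalRing.maximalIdeal ↥(locAtCentre A'.toSubring O)) ∨
    (∃ s c' : ↥(locAtCentre A'.toSubring O), (∑ j : Fin p, c j ^ p * g₀ ^ (j : ℕ)) = (s : K) ∧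
    s - c' ^ p ∈ IsLocalRing.maximalIdeal ↥(locAtCentre A'.toSubring O) ∧
    s - c' ^ p ∉ IsLocalRing.maximalIdeal ↥(locAtCentre A'.toSubring O) ^ 2)) := by
  classical
  haveI : IsFractionRing A K := hfrac
  have hne : O ≠ O₁ := ne_of_residually_independent O O₁ A hAO hAfg hzd y hy hind
  -- a regular model `A₃ ⊇ A ∪ {y₀, y₁}` along `O`
  obtain ⟨A₃, hA₃O, hAA₃, hA₃fg, hyA₃, hreg₃⟩ := exists_regular_model_containing h78 O O₁ hOO₁ hne hO₁ A hAO hAfg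
    hreg hdim3 hzd (Finset.univ.image y) (by
      intro z hz
      rw [Finset.coe_image] at hz
      obtain ⟨i, -, rfl⟩ := hz
      exact hy i)
  have hyA₃' : ∀ i, y i ∈ A₃ := fun i => hyA₃ (by
    rw [Finset.coe_image]; exact ⟨i, Finset.mem_coe.mpr (Finset.mem_univ i), rfl⟩)
  haveI hfrac₃ : IsFractionRing A₃ K := isFractionRing_of_le hAA₃ hfrac
  have hzd₃ : ∀ (T : Subring K) (hT : T ≤ O.toSubring), A₃.toSubring ≤ T → (subringCentre T O hT).IsMaximal :=
    fun T hT h => hzd T hT (le_trans (fun z hz => hAA₃ hz) h)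
  -- dimensions
  have hdimA : ringKrullDim A = 3 := by
    rw [← ringKrullDim_locAtCentre_eq_of_isMaximal A hAfg O hAO (hzd _ hAO le_rfl)]; exact hdim3
  have hdimA₃ : ringKrullDim A₃ = 3 := by
    rw [ringKrullDim_eq_of_fg_of_le hAfg hA₃fg hAA₃]; exact hdimA
  have hdim3₃ : ringKrullDim (locAtCentre A₃.toSubring O) = 3 := by
    rw [ringKrullDim_locAtCentre_eq_of_isMaximal A₃ hA₃fg O hA₃O (hzd₃ _ hA₃O le_rfl)]; exact hdimA₃
  -- the centre of `O₁` on `locAtCentre A₃ O` has height one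
  have hloc₃ : locAtCentre (locAtCentre A₃.toSubring O) O₁ = O₁.toSubring :=
    locAtCentre_locAtCentre_eq_of_residually_independent hOO₁ hO₁ A₃ hA₃O hA₃fg hreg₃ hdimA₃ y hyA₃' hind
  obtain ⟨A', hA'O, hA₃A', hA'fg, hrest⟩ := cleanLU3Defect_of_heightOneCoarsening_of hEmb p hp k hLU2 hpersist K O A₃
    hA₃O hA₃fg hfrac₃ hreg₃ hdim3₃ hzd₃ g₀ hg₀ hdefect O₁ hOO₁ hO₁ hloc₃
  exact ⟨A', hA'O, hAA₃.trans hA₃A', hA'fg, hrest⟩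

end Summit.ResolutionOfSingularities.ResolutionOfSingularities.Theorems.RadicialJung.CleanModels

end
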